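import Summits.KontsevichZagierPeriods.KontsevichZagierPeriods.Theses.FurushoPentagon
import Summits.KontsevichZagierPeriods.KontsevichZagierPeriods.Theses.CoactionDevissage
import Literature.NumberTheory.Transcendental.KZKernelConjectureForms
import Literature.NumberTheory.Transcendental.MZVSimplexRepProofs
import Literature.NumberTheory.Transcendental.MultipleZetaHoffmanRelation
import Literature.NumberTheory.Transcendental.MultipleZetaProofs

/-!
# Crux `HoffmanRelationInKZ` (stmt-KontsevichZagierPeriods-3930): Hoffman's element and its logical position

Support file of the crux disprover (landed copy of §0–§1 of
`Cruxes/HoffmanRelationInKZ/Disproof.lean`, importable by ideators, planners and provers).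

* `hoffmanElement Z s` is literally the element whose membership in `KZ.relations` the crux asserts;
  `hoffmanRelationInKZ_iff` unfolds the crux; `Pinned Z` is its hypothesis on `Z`; `zetaRep` the
  canonical assignment (`ρ` of route CoactionDevissage).
* Every index produced by the raise/split surgery of an admissible index is admissible
  (`isAdmissible_raise`, `isAdmissible_split`), so the `∀ Z`-device collapses:
  `hoffman_iff_canonical`.
* `eval_hoffmanElement_eq_zero`: the value of Hoffman's element vanishes (Hoffman 1992, Thm 5.1 =
  tree theorem `multipleZeta_hoffman_relation`, and Kontsevich's formula `KZ.mzvRep_value_holds`), so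
  by soundness no evaluative refutation of the crux exists; `of_kernel`, `of_summit`,
  `not_summit_of_not`: the kernel conjecture / the summit imply the crux — a refutation of the crux
  refutes `KontsevichZagierPeriods`.
* `iff_hoffmanRegularisation`: the crux is the same statement as CoactionDevissage's crux
  `HoffmanRegularisation` (stmt-KontsevichZagierPeriods-3167).
* `of_zRep_not_mem_relations`: a simplex class `[ζ-rep u]` is never a relation (value `ζ(u) > 0`).

References: M. E. Hoffman, *Multiple harmonic series*, Pacific J. Math. 152 (1992), Thm 5.1;
M. Kontsevich, D. Zagier, *Periods* (2001), §1.2.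
-/

noncomputable section

namespace Summit.KontsevichZagierPeriods.HoffmanRelationInKZ.Negative

open MeasureTheory Set
open Literature.NumberTheory.Transcendental
open Literature.NumberTheory.Transcendental.KZ
open Summit.KontsevichZagierPeriods.KontsevichZagierPeriods.Theses.FurushoPentagon

/-! ## §0 The objects: Hoffman's element, pinned assignments, the canonical assignment -/

/-- The simplex representation `[Δ^w, ω_{ε(s)}]` of `ζ(s)` with the tree's two analytic inputs fed
(the literal sub-term of the crux). -/
abbrev zRep (u : List ℕ) (hu : MZV.IsAdmissible u) : IntegralRep (MZV.weight u) :=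
  mzvRep u hu (mzvIntegrand_isSemialgebraicFunOn_holds u) (mzvIntegrand_integrableOn_holds u hu)

/-- The raised index `(s₁,…,s_i + 1,…,s_k)` (0-based position `i`), in the crux's
`take/getD/drop` spelling. -/
def raise (s : List ℕ) (i : ℕ) : List ℕ := s.take i ++ [s.getD i 0 + 1] ++ s.drop (i + 1)

/-- The split index `(s₁,…,s_{i-1}, s_i − j, j + 1, s_{i+1},…,s_k)`, in the crux's spelling. -/
def split (s : List ℕ) (i j : ℕ) : List ℕ := s.take i ++ [s.getD i 0 - j, j + 1] ++ s.drop (i + 1)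

/-- **Hoffman's element** `H_Z(s) = Σ_i Z(raise s i) − Σ_i Σ_{j ≤ s_i − 2} Z(split s i j)`, literally the
left-hand side of the crux's membership statement. -/
def hoffmanElement (Z : List ℕ → FormalRep) (s : List ℕ) : FormalRep :=
  ((List.range s.length).map (fun i => Z (s.take i ++ [s.getD i 0 + 1] ++ s.drop (i + 1)))).sum -
  ((List.range s.length).map (fun i => ((List.range (s.getD i 0 - 1)).map
    (fun j => Z (s.take i ++ [s.getD i 0 - j, j + 1] ++ s.drop (i + 1)))).sum)).sum

/-- `hoffmanElement` through `raise`/`split`. -/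
theorem hoffmanElement_eq (Z : List ℕ → FormalRep) (s : List ℕ) :
    hoffmanElement Z s = ((List.range s.length).map (fun i => Z (raise s i))).sum -
      ((List.range s.length).map (fun i => ((List.range (s.getD i 0 - 1)).map
        (fun j => Z (split s i j))).sum)).sum := rfl

/-- An assignment `Z : List ℕ → FormalRep` is *pinned* if it agrees with the simplex classes on
admissible indices (the crux's only hypothesis on `Z`). -/
def Pinned (Z : List ℕ → FormalRep) : Prop :=
  ∀ (u : List ℕ) (hu : MZV.IsAdmissible u), Z u = of (zRep u hu)

/-- **The crux, unfolded**: for every pinned `Z` and admissible `s`, `H_Z(s) ∈ relations`. -/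
theorem hoffmanRelationInKZ_iff :
    HoffmanRelationInKZ ↔ ∀ Z, Pinned Z → ∀ s, MZV.IsAdmissible s → hoffmanElement Z s ∈ relations :=
  Iff.rfl

/-- The canonical assignment `ρ(u) = [ζ-rep u]` on admissible `u`, `0` elsewhere (the `ρ` of route
CoactionDevissage). -/
def zetaRep (u : List ℕ) : FormalRep :=
  if h : MZV.IsAdmissible u then of (zRep u h) else 0

/-- `ρ(u) = [ζ-rep u]` on admissible `u`. [folklore] -/
theorem zetaRep_of_isAdmissible {u : List ℕ} (hu : MZV.IsAdmissible u) : zetaRep u = of (zRep u hu) := by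
  simp [zetaRep, hu]

/-- `ρ(u) = 0` off admissible indices. [folklore] -/
theorem zetaRep_of_not_isAdmissible {u : List ℕ} (hu : ¬ MZV.IsAdmissible u) : zetaRep u = 0 := by
  simp [zetaRep, hu]

/-- The canonical assignment is pinned (so the crux's hypothesis is satisfiable: no vacuity). -/
theorem pinned_zetaRep : Pinned zetaRep := fun _ hu => zetaRep_of_isAdmissible hu

/-- `eval` of the canonical assignment is the multiple zeta value on admissible indices
(Kontsevich's formula, `KZ.mzvRep_value_holds`). -/
theorem eval_zetaRep {u : List ℕ} (hu : MZV.IsAdmissible u) : eval (zetaRep u) = multipleZeta u := by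
  rw [zetaRep_of_isAdmissible hu, eval_of]
  exact mzvRep_value_holds u hu _ _

/-- A pinned assignment evaluates to the multiple zeta values (Kontsevich's formula). [folklore] -/
theorem eval_of_pinned {Z : List ℕ → FormalRep} (hZ : Pinned Z) {u : List ℕ} (hu : MZV.IsAdmissible u) :
    eval (Z u) = multipleZeta u := by
  rw [hZ u hu, eval_of]
  exact mzvRep_value_holds u hu _ _

/-! ### Admissibility of the surgery indices (no junk-`Z` escape) -/

/-- `s.getD i 0 = s[i]` in range. [folklore] -/
theorem getD_eq_getElem {s : List ℕ} {i : ℕ} (hi : i < s.length) : s.getD i 0 = s[i] := by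
  rw [List.getD_eq_getElem?_getD, List.getElem?_eq_getElem hi, Option.getD_some]

/-- Entries of an admissible index are positive. [folklore] -/
theorem one_le_getElem_of_isAdmissible {s : List ℕ} (hs : MZV.IsAdmissible s) {i : ℕ}
    (hi : i < s.length) : 1 ≤ s[i] :=
  hs.1 _ (List.getElem_mem hi)

/-- Raising position `0`. [folklore] -/
@[simp] theorem raise_cons_zero (a : ℕ) (t : List ℕ) : raise (a :: t) 0 = (a + 1) :: t := by
  simp [raise]

/-- Raising a later position commutes with `cons`. [folklore] -/
@[simp] theorem raise_cons_succ (a : ℕ) (t : List ℕ) (i : ℕ) :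
    raise (a :: t) (i + 1) = a :: raise t i := by
  simp [raise]

/-- Splitting position `0`. [folklore] -/
@[simp] theorem split_cons_zero (a : ℕ) (t : List ℕ) (j : ℕ) :
    split (a :: t) 0 j = (a - j) :: (j + 1) :: t := by
  simp [split]

/-- Splitting a later position commutes with `cons`. [folklore] -/
@[simp] theorem split_cons_succ (a : ℕ) (t : List ℕ) (i j : ℕ) :
    split (a :: t) (i + 1) j = a :: split t i j := by
  simp [split]

/-- Raising an entry keeps all entries positive. -/
theorem forall_one_le_raise {t : List ℕ} (ht : ∀ x ∈ t, 1 ≤ x) (i : ℕ) : ∀ x ∈ raise t i, 1 ≤ x := by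
  intro x hx
  simp only [raise, List.mem_append, List.mem_singleton] at hx
  rcases hx with (hx | rfl) | hx
  · exact ht x (List.mem_of_mem_take hx)
  · omega
  · exact ht x (List.mem_of_mem_drop hx)

/-- Splitting an entry `s_i` at `j < s_i − 1` keeps all entries positive. -/
theorem forall_one_le_split {t : List ℕ} (ht : ∀ x ∈ t, 1 ≤ x) {i j : ℕ} (hj : j < t.getD i 0 - 1) :
    ∀ x ∈ split t i j, 1 ≤ x := by
  intro x hx
  simp only [split, List.mem_append, List.mem_cons, List.not_mem_nil, or_false] at hx
  rcases hx with (hx | rfl | rfl) | hx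
  · exact ht x (List.mem_of_mem_take hx)
  · omega
  · omega
  · exact ht x (List.mem_of_mem_drop hx)

/-- Raised indices of a (nonempty) admissible index are admissible. -/
theorem isAdmissible_raise {s : List ℕ} (hs : MZV.IsAdmissible s) {i : ℕ} (hi : i < s.length) :
    MZV.IsAdmissible (raise s i) := by
  cases s with
  | nil => simp at hi
  | cons a t =>
    rw [MZV.isAdmissible_cons_iff] at hs
    cases i with
    | zero =>
      rw [raise_cons_zero, MZV.isAdmissible_cons_iff]
      exact ⟨by omega, hs.2⟩
    | succ i =>
      rw [raise_cons_succ, MZV.isAdmissible_cons_iff]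
      exact ⟨hs.1, forall_one_le_raise hs.2 i⟩

/-- Split indices of an admissible index are admissible (`j ≤ s_i − 2` keeps `s_i − j ≥ 2`). -/
theorem isAdmissible_split {s : List ℕ} (hs : MZV.IsAdmissible s) {i : ℕ} (hi : i < s.length) {j : ℕ}
    (hj : j < s.getD i 0 - 1) : MZV.IsAdmissible (split s i j) := by
  cases s with
  | nil => simp at hi
  | cons a t =>
    rw [MZV.isAdmissible_cons_iff] at hs
    cases i with
    | zero =>
      simp only [List.getD_cons_zero] at hj
      rw [split_cons_zero, MZV.isAdmissible_cons_iff]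
      refine ⟨by omega, ?_⟩
      intro x hx
      rcases List.mem_cons.mp hx with rfl | hx
      · omega
      · exact hs.2 x hx
    | succ i =>
      simp only [List.getD_cons_succ] at hj
      rw [split_cons_succ, MZV.isAdmissible_cons_iff]
      exact ⟨hs.1, forall_one_le_split hs.2 hj⟩

/-- Two assignments agreeing on admissible indices have the same Hoffman element at admissible `s`. -/
theorem hoffmanElement_congr {Z Z' : List ℕ → FormalRep} (h : ∀ u, MZV.IsAdmissible u → Z u = Z' u)
    {s : List ℕ} (hs : MZV.IsAdmissible s) : hoffmanElement Z s = hoffmanElement Z' s := by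
  rw [hoffmanElement_eq, hoffmanElement_eq]
  congr 1
  · congr 1
    refine List.map_congr_left fun i hi => ?_
    exact h _ (isAdmissible_raise hs (List.mem_range.mp hi))
  · congr 1
    refine List.map_congr_left fun i hi => ?_
    congr 1
    refine List.map_congr_left fun j hj => ?_
    exact h _ (isAdmissible_split hs (List.mem_range.mp hi) (List.mem_range.mp hj))

/-- A pinned assignment has the canonical Hoffman elements. -/
theorem hoffmanElement_eq_of_pinned {Z : List ℕ → FormalRep} (hZ : Pinned Z) {s : List ℕ}
    (hs : MZV.IsAdmissible s) : hoffmanElement Z s = hoffmanElement zetaRep s :=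
  hoffmanElement_congr (fun u hu => by rw [hZ u hu, zetaRep_of_isAdmissible hu]) hs

/-- **The `∀ Z`-device collapses**: the crux is the statement about the canonical classes. -/
theorem hoffman_iff_canonical :
    HoffmanRelationInKZ ↔ ∀ s, MZV.IsAdmissible s → hoffmanElement zetaRep s ∈ relations := by
  rw [hoffmanRelationInKZ_iff]
  constructor
  · intro h s hs
    exact h zetaRep pinned_zetaRep s hs
  · intro h Z hZ s hs
    rw [hoffmanElement_eq_of_pinned hZ hs]
    exact h s hs


/-! ## §1 Logical position: the value identity is a tree theorem, so the crux is summit-implied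

`eval H_Z(s) = Σ_l ζ(raise) − Σ_l Σ_j ζ(split) = 0` is Hoffman 1992 Thm 5.1, PROVED in the tree
(`multipleZeta_hoffman_relation`) once the crux's `List.range/getD` sums are converted to the fact's
`Fin/get` sums; with Kontsevich's formula (`mzvRep_value_holds`, proved) every pinned `Z` evaluates to
the MZVs. Hence the kernel conjecture — equivalently the summit — implies the crux, and a refutation
of the crux is a refutation of Conjecture 1: the separating invariant would have to be NON-evaluative. -/

/-- `((List.range n).map f).sum` as a `Finset.range` sum. [folklore] -/
theorem list_sum_range_map_finset {M : Type*} [AddCommMonoid M] (n : ℕ) (f : ℕ → M) :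
    ((List.range n).map f).sum = ∑ i ∈ Finset.range n, f i := by
  induction n with
  | zero => simp
  | succ n ih =>
    rw [List.range_succ, List.map_append, List.sum_append, ih, Finset.sum_range_succ]
    simp

/-- `((List.range n).map f).sum` as a sum over `Fin n`. [folklore] -/
theorem list_sum_range_map_fin {M : Type*} [AddCommMonoid M] (n : ℕ) (f : ℕ → M) :
    ((List.range n).map f).sum = ∑ i : Fin n, f i := by
  rw [list_sum_range_map_finset, Finset.sum_range]

/-- `s.getD l 0 = s.get l` for `l : Fin s.length`. [folklore] -/
theorem getD_fin (s : List ℕ) (l : Fin s.length) : s.getD l 0 = s.get l := by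
  rw [getD_eq_getElem l.2, List.get_eq_getElem]

/-- **Hoffman's element in the `Fin/get` indexing** of the tree fact `hoffman_relation` and of the twin
crux `CoactionDevissage.HoffmanRegularisation`. -/
theorem hoffmanElement_eq_finSum (Z : List ℕ → FormalRep) (s : List ℕ) :
    hoffmanElement Z s =
      (∑ l : Fin s.length, Z (s.take l.1 ++ [s.get l + 1] ++ s.drop (l.1 + 1))) -
        ∑ l : Fin s.length, ∑ j ∈ Finset.range (s.get l - 1),
          Z (s.take l.1 ++ [s.get l - j, j + 1] ++ s.drop (l.1 + 1)) := by
  unfold hoffmanElement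
  rw [list_sum_range_map_fin, list_sum_range_map_fin]
  congr 1
  · refine Finset.sum_congr rfl fun l _ => ?_
    rw [getD_fin]
  · refine Finset.sum_congr rfl fun l _ => ?_
    rw [list_sum_range_map_finset, getD_fin]

/-- **The value of Hoffman's element** for a pinned assignment is the two sides of Hoffman's printed
relation. [cite: Hoffman1992, Theorem 5.1] -/
theorem eval_hoffmanElement {Z : List ℕ → FormalRep} (hZ : Pinned Z) {s : List ℕ}
    (hs : MZV.IsAdmissible s) :
    eval (hoffmanElement Z s) =
      (∑ l : Fin s.length, multipleZeta (s.take l.1 ++ [s.get l + 1] ++ s.drop (l.1 + 1))) -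
        ∑ l : Fin s.length, ∑ j ∈ Finset.range (s.get l - 1),
          multipleZeta (s.take l.1 ++ [s.get l - j, j + 1] ++ s.drop (l.1 + 1)) := by
  rw [hoffmanElement_eq_finSum, map_sub, map_sum, map_sum]
  congr 1
  · refine Finset.sum_congr rfl fun l _ => ?_
    have h := isAdmissible_raise hs l.2
    rw [raise, getD_fin] at h
    exact eval_of_pinned hZ h
  · refine Finset.sum_congr rfl fun l _ => ?_
    rw [map_sum]
    refine Finset.sum_congr rfl fun j hj => ?_
    have h := isAdmissible_split hs l.2 (j := j) (by rw [getD_fin]; exact Finset.mem_range.mp hj)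
    rw [split, getD_fin] at h
    exact eval_of_pinned hZ h

/-- **`eval H_Z(s) = 0`** (Hoffman 1992 Thm 5.1, tree theorem `multipleZeta_hoffman_relation`):
no EVALUATIVE refutation of the crux exists. [cite: Hoffman1992, Theorem 5.1] -/
theorem eval_hoffmanElement_eq_zero {Z : List ℕ → FormalRep} (hZ : Pinned Z) {s : List ℕ}
    (hs : MZV.IsAdmissible s) : eval (hoffmanElement Z s) = 0 := by
  rw [eval_hoffmanElement hZ hs, multipleZeta_hoffman_relation hs, sub_self]

/-- **Kernel conjecture ⇒ crux.** [folklore] -/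
theorem of_kernel (hK : KZKernelConjecture) : HoffmanRelationInKZ :=
  fun _ hZ _ hs => hK _ (eval_hoffmanElement_eq_zero hZ hs)

/-- The kernel FORM written out (the conclusion of the route's `SectorToKernel`) ⇒ crux. [folklore] -/
theorem of_kernelForm (hK : ∀ c : FormalRep, eval c = 0 → c ∈ relations) : HoffmanRelationInKZ :=
  of_kernel hK

/-- **Summit ⇒ crux** (`kzKernelConjecture_iff_isRational`, `KontsevichZagierPeriods_iff`). [folklore] -/
theorem of_summit (h : KontsevichZagierPeriods) : HoffmanRelationInKZ :=
  of_kernel (kzKernelConjecture_iff_isRational.mpr (KontsevichZagierPeriods_iff.mp h))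

/-- **A kill of this crux is a kill of the summit.** [folklore] -/
theorem not_summit_of_not (h : ¬ HoffmanRelationInKZ) : ¬ KontsevichZagierPeriods :=
  fun hs => h (of_summit hs)

/-- **Shape of any counterexample**: a refutation exhibits an admissible `s` whose canonical Hoffman
element is a non-relation of value `0` — an element of `ker eval ∖ relations`. [folklore] -/
theorem counterexample_shape (h : ¬ HoffmanRelationInKZ) :
    ∃ s, MZV.IsAdmissible s ∧ eval (hoffmanElement zetaRep s) = 0 ∧
      hoffmanElement zetaRep s ∉ relations := by
  rw [hoffman_iff_canonical] at h
  push Not at h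
  obtain ⟨s, hs, hns⟩ := h
  exact ⟨s, hs, eval_hoffmanElement_eq_zero pinned_zetaRep hs, hns⟩

/-- **TWIN**: the crux is the same statement as route CoactionDevissage's crux `HoffmanRegularisation`
(stmt-KontsevichZagierPeriods-3167): the `∀ Z`-device collapses to the canonical `ρ` and the
`List.range/getD` sums are the `Fin/get` sums. A proof or refutation of either closes both. [folklore] -/
theorem iff_hoffmanRegularisation :
    HoffmanRelationInKZ ↔ Summit.KontsevichZagierPeriods.KontsevichZagierPeriods.Theses.CoactionDevissage.HoffmanRegularisation := by
  rw [hoffman_iff_canonical]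
  unfold Summit.KontsevichZagierPeriods.KontsevichZagierPeriods.Theses.CoactionDevissage.HoffmanRegularisation
  simp only [hoffmanElement_eq_finSum]
  exact Iff.rfl



/-! ## The basic non-relation -/

/-- **`[ζ-rep u] ∉ relations`** for admissible `u`: it evaluates to `ζ(u) > 0`
(`multipleZeta_pos_of_isAdmissible_holds`), relations evaluate to `0` (soundness). [folklore] -/
theorem of_zRep_not_mem_relations {u : List ℕ} (hu : MZV.IsAdmissible u) : of (zRep u hu) ∉ relations := by
  intro h
  have h0 : eval (of (zRep u hu)) = 0 := relations_le_ker_eval_holds h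
  rw [eval_of, mzvRep_value_holds] at h0
  exact (multipleZeta_pos_of_isAdmissible_holds hu).ne' h0

/-- `ρ(u) ∉ relations` for admissible `u`. [folklore] -/
theorem zetaRep_not_mem_relations {u : List ℕ} (hu : MZV.IsAdmissible u) : zetaRep u ∉ relations := by
  rw [zetaRep_of_isAdmissible hu]; exact of_zRep_not_mem_relations hu

/-! ## Small instances, unfolded -/

/-- `s = ()`: the element is `0` (trivially a relation). -/
theorem hoffmanElement_nil (Z : List ℕ → FormalRep) : hoffmanElement Z [] = 0 := by
  simp [hoffmanElement]

/-- `s = (2)`: `Z(3) − Z(2,1)` (Euler's `ζ(3) = ζ(2,1)`). -/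
theorem hoffmanElement_two (Z : List ℕ → FormalRep) : hoffmanElement Z [2] = Z [3] - Z [2, 1] := by
  simp [hoffmanElement]

/-- `s = (3)`: `Z(4) − (Z(3,1) + Z(2,2))` — the first instance beyond duality. -/
theorem hoffmanElement_three (Z : List ℕ → FormalRep) :
    hoffmanElement Z [3] = Z [4] - (Z [3, 1] + Z [2, 2]) := by
  simp [hoffmanElement, List.range_succ]

/-- `s = (2,1)`: `(Z(3,1) + Z(2,2)) − Z(2,1,1)`. -/
theorem hoffmanElement_two_one (Z : List ℕ → FormalRep) :
    hoffmanElement Z [2, 1] = Z [3, 1] + Z [2, 2] - Z [2, 1, 1] := by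
  simp [hoffmanElement, List.range_succ]

end Summit.KontsevichZagierPeriods.HoffmanRelationInKZ.Negative
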